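import Literature.Analysis.FluidPDE.TaoEnstrophyLocalisationProofs
import Mathlib.Analysis.FunctionalSpaces.SobolevInequality
import Mathlib.Analysis.SpecialFunctions.Pow.Integral
import HarnessLib

/-!
# A Sobolev bound for quadratic potentials: `∫ V |ψ|² ≤ ‖V‖_{3/2} · C² ∫ |∇ψ|²_F` on `ℝ³`

Analysis/FluidPDE support file (serves the "Sobolev face" of the stretching-well binding form,
`StretchingRate.lean`, route `StretchingWellBinding` of `NavierStokesRegularity`).

For a nonnegative potential `V ∈ L^{3/2}(ℝ³)` and a vector test field `ψ ∈ C¹_c(ℝ³; ℝ³)`: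

* `integral_norm_pow_six_rpow_le` — the Gagliardo–Nirenberg–Sobolev inequality `Ḣ¹ ⊂ L⁶` for
  vector fields in integral form, `(∫ |ψ|⁶)^{1/3} ≤ C² ∫ |∇ψ|²_F`, with `C` Mathlib's GNS constant
  `eLpNormLESNormFDerivOfEqInnerConst volume 2` (`p = 2`, `n = 3`; not the sharp Talenti constant)
  and the Frobenius norm `frobeniusNormSq` of the gradient (`≥` operator norm squared);
* `integral_mul_norm_sq_le_holder` — Hölder with exponents `3/2` and `3`:
  `∫ V |ψ|² ≤ (∫ V^{3/2})^{2/3} (∫ |ψ|⁶)^{1/3}`;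
* `integral_mul_norm_sq_le_sobolev` — the combination
  `∫ V |ψ|² ≤ (∫ V^{3/2})^{2/3} · C² ∫ |∇ψ|²_F`: a potential that is small in `L^{3/2}` is
  form-bounded by the Dirichlet form.

## References

* Mathlib, `MeasureTheory.eLpNorm_le_eLpNorm_fderiv_of_eq_inner` (GNS); L. C. Evans, *PDE*,
  2nd ed., §5.6.1 Thm. 1. Classical use: the CLR / Cwikel–Lieb–Rozenblum-type smallness
  criterion for the absence of bound states of `−Δ − V` in `ℝ³`.
-/

noncomputable section

open MeasureTheory Set Function Filter
open scoped NNReal ENNReal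

namespace Literature.Analysis.FluidPDE

variable {ψ : EuclideanSpace ℝ (Fin 3) → EuclideanSpace ℝ (Fin 3)}
variable {V : EuclideanSpace ℝ (Fin 3) → ℝ}

/-- **GNS for vector fields on `ℝ³`, integral form**: for `ψ ∈ C¹_c(ℝ³; ℝ³)`,
`(∫ |ψ|⁶)^{1/3} ≤ C² ∫ |∇ψ|²_F` with `C = eLpNormLESNormFDerivOfEqInnerConst volume 2`
(Mathlib's Gagliardo–Nirenberg–Sobolev constant for `p = 2`, `n = 3`). [folklore] -/
theorem integral_norm_pow_six_rpow_le (hψ : ContDiff ℝ 1 ψ) (hc : HasCompactSupport ψ) :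
    (∫ x, ‖ψ x‖ ^ 6) ^ ((3 : ℝ)⁻¹) ≤
      ((eLpNormLESNormFDerivOfEqInnerConst
          (volume : Measure (EuclideanSpace ℝ (Fin 3))) 2 : ℝ≥0) : ℝ) ^ 2 *
        ∫ x, frobeniusNormSq (fderiv ℝ ψ x) := by
  set C : ℝ≥0 := eLpNormLESNormFDerivOfEqInnerConst
    (volume : Measure (EuclideanSpace ℝ (Fin 3))) 2 with hC
  have hψm : MemLp ψ ((6 : ℝ≥0) : ℝ≥0∞) volume := hψ.continuous.memLp_of_hasCompactSupport hc
  have hDc : Continuous (fderiv ℝ ψ) := hψ.continuous_fderiv one_ne_zero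
  have hDm : MemLp (fderiv ℝ ψ) ((2 : ℝ≥0) : ℝ≥0∞) volume :=
    hDc.memLp_of_hasCompactSupport (hc.fderiv ℝ)
  have h := eLpNorm_le_eLpNorm_fderiv_of_eq_inner
    (μ := (volume : Measure (EuclideanSpace ℝ (Fin 3)))) hψ hc (p := 2) (p' := 6) (by norm_num)
    (by rw [finrank_euclideanSpace_fin]; norm_num) (by rw [finrank_euclideanSpace_fin]; norm_num)
  have hC' : eLpNormLESNormFDerivOfEqInnerConst
      (volume : Measure (EuclideanSpace ℝ (Fin 3))) ((2 : ℝ≥0) : ℝ) = C := by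
    rw [hC, NNReal.coe_ofNat]
  rw [hC'] at h
  rw [hψm.eLpNorm_eq_integral_rpow_norm (by norm_num) ENNReal.coe_ne_top,
    hDm.eLpNorm_eq_integral_rpow_norm (by norm_num) ENNReal.coe_ne_top] at h
  simp only [ENNReal.coe_ofNat, ENNReal.toReal_ofNat] at h
  set I₆ := ∫ x, ‖ψ x‖ ^ (6 : ℝ) with hI₆
  set I₂ := ∫ x, ‖fderiv ℝ ψ x‖ ^ (2 : ℝ) with hI₂
  have hI₆0 : 0 ≤ I₆ := integral_nonneg fun x => by positivity
  have hI₂0 : 0 ≤ I₂ := integral_nonneg fun x => by positivity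
  rw [← ENNReal.ofReal_coe_nnreal, ← ENNReal.ofReal_mul (NNReal.coe_nonneg C),
    ENNReal.ofReal_le_ofReal_iff (mul_nonneg (NNReal.coe_nonneg C) (Real.rpow_nonneg hI₂0 _))] at h
  -- square: `(I₆^{1/6})² = I₆^{1/3}`, `(C I₂^{1/2})² = C² I₂`
  have h2 := pow_le_pow_left₀ (Real.rpow_nonneg hI₆0 _) h 2
  have e1 : (I₆ ^ (6 : ℝ)⁻¹) ^ (2 : ℕ) = I₆ ^ ((3 : ℝ)⁻¹) := by
    rw [← Real.rpow_natCast, ← Real.rpow_mul hI₆0]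
    norm_num
  have e2 : (I₂ ^ (2 : ℝ)⁻¹) ^ (2 : ℕ) = I₂ := by
    rw [← Real.rpow_natCast, ← Real.rpow_mul hI₂0]
    norm_num
  rw [e1, mul_pow, e2] at h2
  -- back to natural powers, and operator norm ≤ Frobenius norm
  have hI₆' : ∫ x, ‖ψ x‖ ^ 6 = I₆ :=
    integral_congr_ae (Eventually.of_forall fun x => by
      simp only [show (6 : ℝ) = ((6 : ℕ) : ℝ) by norm_num, Real.rpow_natCast])
  have hI₂' : ∫ x, ‖fderiv ℝ ψ x‖ ^ 2 = I₂ :=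
    integral_congr_ae (Eventually.of_forall fun x => (Real.rpow_two _).symm)
  have hFc : Continuous fun x => frobeniusNormSq (fderiv ℝ ψ x) :=
    continuous_frobeniusNormSq_fderiv hψ one_ne_zero
  have hFi : Integrable fun x => frobeniusNormSq (fderiv ℝ ψ x) :=
    hFc.integrable_of_hasCompactSupport
      (HasCompactSupport.intro hc fun _ hx => by simp [fderiv_of_notMem_tsupport ℝ hx])
  have hD2i : Integrable fun x => ‖fderiv ℝ ψ x‖ ^ 2 :=
    (hDc.norm.pow 2).integrable_of_hasCompactSupport
      (HasCompactSupport.intro hc fun _ hx => by simp [fderiv_of_notMem_tsupport ℝ hx])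
  have hle : I₂ ≤ ∫ x, frobeniusNormSq (fderiv ℝ ψ x) := by
    rw [← hI₂']
    exact integral_mono hD2i hFi fun x => sq_opNorm_le_frobeniusNormSq _
  rw [hI₆']
  exact h2.trans (mul_le_mul_of_nonneg_left hle (sq_nonneg _))

/-- **Hölder with exponents `3/2` and `3`**: for `V ≥ 0` in `L^{3/2}(ℝ³)` and a continuous
compactly supported field `ψ`, `∫ V |ψ|² ≤ (∫ V^{3/2})^{2/3} (∫ |ψ|⁶)^{1/3}`. [folklore] -/
theorem integral_mul_norm_sq_le_holder (hV0 : 0 ≤ᵐ[volume] V)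
    (hV : MemLp V (ENNReal.ofReal (3 / 2)) volume) (hψ : Continuous ψ)
    (hc : HasCompactSupport ψ) :
    ∫ x, V x * ‖ψ x‖ ^ 2 ≤
      (∫ x, V x ^ (3 / 2 : ℝ)) ^ (2 / 3 : ℝ) * (∫ x, ‖ψ x‖ ^ 6) ^ ((3 : ℝ)⁻¹) := by
  have hpq : (3 / 2 : ℝ).HolderConjugate 3 := Real.holderConjugate_iff.2 ⟨by norm_num, by norm_num⟩
  have hg : MemLp (fun x => ‖ψ x‖ ^ 2) (ENNReal.ofReal 3) volume :=
    (hψ.norm.pow 2).memLp_of_hasCompactSupport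
      (HasCompactSupport.intro hc fun _ hx => by simp [image_eq_zero_of_notMem_tsupport hx])
  have h := integral_mul_le_Lp_mul_Lq_of_nonneg hpq hV0 (ae_of_all _ fun x => sq_nonneg ‖ψ x‖)
    hV hg
  have e1 : (1 : ℝ) / (3 / 2) = 2 / 3 := by norm_num
  have e2 : (1 : ℝ) / 3 = (3 : ℝ)⁻¹ := by norm_num
  have e3 : ∫ x, (‖ψ x‖ ^ 2) ^ (3 : ℝ) = ∫ x, ‖ψ x‖ ^ 6 :=
    integral_congr_ae (Eventually.of_forall fun x => by
      simp only [show (3 : ℝ) = ((3 : ℕ) : ℝ) by norm_num, Real.rpow_natCast, ← pow_mul])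
  rw [e1, e2, e3] at h
  exact h

/-- **Sobolev potential bound**: for `V ≥ 0` in `L^{3/2}(ℝ³)` and `ψ ∈ C¹_c(ℝ³; ℝ³)`,
`∫ V |ψ|² ≤ (∫ V^{3/2})^{2/3} · C² ∫ |∇ψ|²_F` (`C` Mathlib's GNS constant for `p = 2`, `n = 3`):
the quadratic form of a potential small in `L^{3/2}` is dominated by the Dirichlet form. [folklore] -/
theorem integral_mul_norm_sq_le_sobolev (hV0 : 0 ≤ᵐ[volume] V)
    (hV : MemLp V (ENNReal.ofReal (3 / 2)) volume) (hψ : ContDiff ℝ 1 ψ)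
    (hc : HasCompactSupport ψ) :
    ∫ x, V x * ‖ψ x‖ ^ 2 ≤
      (∫ x, V x ^ (3 / 2 : ℝ)) ^ (2 / 3 : ℝ) *
        (((eLpNormLESNormFDerivOfEqInnerConst
            (volume : Measure (EuclideanSpace ℝ (Fin 3))) 2 : ℝ≥0) : ℝ) ^ 2 *
          ∫ x, frobeniusNormSq (fderiv ℝ ψ x)) := by
  have hA : 0 ≤ (∫ x, V x ^ (3 / 2 : ℝ)) ^ (2 / 3 : ℝ) := by
    refine Real.rpow_nonneg (integral_nonneg_of_ae ?_) _
    filter_upwards [hV0] with x hx using Real.rpow_nonneg hx _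
  exact (integral_mul_norm_sq_le_holder hV0 hV hψ.continuous hc).trans
    (mul_le_mul_of_nonneg_left (integral_norm_pow_six_rpow_le hψ hc) hA)

end Literature.Analysis.FluidPDE

end
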